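import Literature.MathematicalPhysics.QuantumFieldTheory.Balaban1983to89.T4TrajectoryDensity

/-!
# `T4Continuum.T4TrajectoryDensityWitness` (part 1 of 2: the toy and its closed forms) — a K = 2 JOINT INHABITATION WITNESS of
# the dressed lattice pipeline `T4TrajectoryDensity.transportsFromVar_of_exponentSlicesAt_lattice` (v1.2.1): ALL its binders at
# once, on ONE explicit `ℤ⁴`/`ℂ` toy with two met RG steps, properly nested windows, a two-atom fluctuation measure and a
# background-DEPENDENT exponent (cell `pub-balaban`, sub-cell `t4`, spine estimate NE1′ (node O3b/H2), fan-out lineage t4-ne1p-p1 =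
# PROVER seat P1, technique «RG-trajectory comparison», generation 20; tree target `Summits/QuantumFields/BalabanUV/T4Continuum/Support/`;
# ADDITIVE — imports the Literature leaf `T4TrajectoryDensity` ONLY and modifies nothing; part 2 `T4TrajectoryDensityWitnessK2` =
# the 21 binders and the conclusion BY NAME; one namespace for both parts)

HONEST FRAMING.  Finite four-torus, rung (B)+1 only (the `ε → 0` limit of unit-scale averaged loop expectations on ONE torus of
fixed size) — NOT infinite volume, NOT a mass gap, NOT the Clay problem, NOT summit progress.  (B), `BetaPertHyp`, (B^μ) are not
mentioned because nothing here consumes them.  THIS MODULE IS A TOY: it encodes NOTHING of Bałaban's densities or of the kernels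
(1.73)–(1.75) of [Balaban1989LargeFieldII] pp. 379–380 (CONTEXT only, carried verbatim by the imported leaf's header, not re-quoted);
every declaration is [folklore] kernel mathematics (two Dirac masses, one logistic weight, bond-ball arithmetic), 0 sorry,
0 citations (no `[cite:]` tag: nothing printed is transcribed; the sibling `PrecisionDecayWitness` is the precedent for the genre).

WHY THIS LEAF (record `t4/T4-EST-NE1p-P1.md`, generation 20).  Generation 19 found (F-g19, `exponent_locallyConst_of_capstone_binders`)
that the v1.1 binder family of the dressed pipeline was JOINTLY DEGENERATE — each hypothesis shape inhabited by its own toy, but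
together (real base at EVERY window point + holomorphic slices + nesting (N2)) forcing the exponent `𝒜 k` to be locally
background-INDEPENDENT — and re-cut the seam (v1.2: reality and oscillation asked at a REFERENCE `ref k U₀`: `RealBaseAt`,
`ExponentSliceAt`).  A re-cut motivated by a JOINT degeneracy owes a JOINT witness: one datum meeting all 21 binders (`hα … hlin`)
of `transportsFromVar_of_exponentSlicesAt_lattice` SIMULTANEOUSLY, with (i) more than one met step, (ii) no vacuous gate, (iii)
PROPER nested windows, (iv) an exponent that genuinely depends on the background at an atom of the fluctuation measure, (v) carried
functionals DEFINED by the literal `wOp` recursion (so `hFn` is definitional and the dressing really acts), (vi) the trajectory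
currency `lin` PROVED from the dressed functionals.  Parts 1–2 are that witness; on the SAME data the v1.1 conclusion of F-g19
FAILS (`not_locallyConst`) and v1.1's `RealBase` FAILS (`not_realBase`) — the v1.2 binder set is jointly satisfiable exactly
where v1.1's was not.  VALUE = a consistency certificate for the v1.2 re-cut; it says NOTHING about whether Bałaban's densities
meet the shapes (NOT PRINTED; the record's cell wall (w1)–(w7) is unchanged).

THE TOY.  `d = 4`, `R = F = ℂ`; fluctuation measure `flTwo = δ_0 + δ_{z_H}`, `z_H ≡ 1/50`; `base ≡ 1`; exponent `𝒜 U z = U₀₀·z₀₀/10`;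
reference `ref U = Re U` bond-wise; birth functional `10·U₀₀` (family born at scale 0), `0` for later generations; carried
functionals `Fn k' (k+1) U = wOp (expWeight base 𝒜) flTwo 0 U (z ↦ Fn k' k (U + z))` BY DEFINITION.  Closed forms (this part):
`wOp … U h = h 0 + λ(U)(h z_H − h 0)` with the logistic weight `λ(U) = ω_U(z_H)/(1 + ω_U(z_H))`, `ω_U(z_H) = e^{−U₀₀/500}`,
`‖λ(U)‖ ≤ 3/5` for `‖U₀₀‖ ≤ 1` (`Complex.norm_exp_sub_one_le`); `Fn 0 1 U = 10U₀₀ + λ(U)/5`; `Fn 0 2 U = 10U₀₀ + (2λ + λλ′ − λ²)/5`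
(`λ′ = λ(U + z_H)`); the dressing error `‖Fn 0 k U − 10U₀₀‖ ≤ 2/5` (`k ≤ 2`, `‖U₀₀‖ ≤ ½`), whence the oscillation `≥ 6/5`
between `0` and any `U₁` with `U₁(0,0) = 1/5` — the trajectory currency `lin = 1` of part 2.
-/

namespace Summit.QuantumFields.BalabanUV.T4Continuum.T4TrajectoryDensityWitness

open MeasureTheory Set Metric Filter
open Literature.MathematicalPhysics.QuantumFieldTheory.Balaban1983to89
open T4BlockTransport (Fld NDir latMove latN Site)
open T4TrajectoryDensity

noncomputable section

/-! ## §1 The two-atom fluctuation measure on `Fld 4 ℂ` and its calculus [folklore] -/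

/-- Evaluation at the bond `⟨0, 0⟩` (site `0`, direction `0`). [folklore] -/
def ev₀₀ (U : Fld 4 ℂ) : ℂ := U 0 0

/-- The unit bond field supported on the bond `⟨0, 0⟩`. [folklore] -/
def e₀₀ : Fld 4 ℂ := fun x ν => if x = 0 ∧ ν = 0 then 1 else 0

/-- The second atom of the fluctuation measure: the constant bond field `1/50`. [folklore] -/
def atomH : Fld 4 ℂ := fun _ _ => ((1 / 50 : ℝ) : ℂ)

/-- The fluctuation measure: unit Dirac masses at `0` and at `atomH`. [folklore] -/
def flTwo : Measure (Fld 4 ℂ) := Measure.dirac 0 + Measure.dirac atomH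

/-- [folklore] -/ @[simp] theorem ev₀₀_zero : ev₀₀ (0 : Fld 4 ℂ) = 0 := rfl
/-- [folklore] -/ @[simp] theorem ev₀₀_add (U z : Fld 4 ℂ) : ev₀₀ (U + z) = ev₀₀ U + ev₀₀ z := rfl
/-- [folklore] -/ @[simp] theorem ev₀₀_smul (c : ℂ) (U : Fld 4 ℂ) : ev₀₀ (c • U) = c * ev₀₀ U := rfl
/-- [folklore] -/ @[simp] theorem ev₀₀_atomH : ev₀₀ atomH = ((1 / 50 : ℝ) : ℂ) := rfl
/-- [folklore] -/ @[simp] theorem ev₀₀_e₀₀ : ev₀₀ e₀₀ = 1 := by simp [ev₀₀, e₀₀]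
/-- The chart moves `U₀₀` affinely. [folklore] -/
theorem ev₀₀_latMove (U : Fld 4 ℂ) (p : NDir 4 ℂ) (t : ℂ) : ev₀₀ (latMove U p t) = ev₀₀ U + t * ev₀₀ p.1.1 := rfl
/-- [folklore] -/
theorem norm_e₀₀_le (x : Site 4) (ν : Fin 4) : ‖e₀₀ x ν‖ ≤ 1 := by
  unfold e₀₀; split_ifs <;> simp

/-- Almost everywhere for the two-atom measure = at both atoms. [folklore] -/
theorem ae_two {p : Fld 4 ℂ → Prop} : (∀ᵐ z ∂flTwo, p z) ↔ p 0 ∧ p atomH := by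
  unfold flTwo
  rw [ae_add_measure_iff, ae_dirac_eq, ae_dirac_eq]
  simp [Filter.eventually_pure]

/-- Modulo a Dirac mass every function is a.e. equal to its value at the atom. [folklore] -/
private theorem aeeq_dirac {E : Type*} (a : Fld 4 ℂ) (f : Fld 4 ℂ → E) : f =ᵐ[Measure.dirac a] fun _ => f a := by
  rw [Filter.EventuallyEq, ae_dirac_eq]; simp

variable {E : Type*} [NormedAddCommGroup E]

/-- Every function is integrable against the two-atom measure. [folklore] -/
theorem integrable_two (f : Fld 4 ℂ → E) : Integrable f flTwo :=
  ((integrable_const (f 0)).congr (aeeq_dirac 0 f).symm).add_measure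
    ((integrable_const (f atomH)).congr (aeeq_dirac atomH f).symm)

/-- Every function is a.e.-strongly measurable for the two-atom measure. [folklore] -/
theorem aesm_two (f : Fld 4 ℂ → E) : AEStronglyMeasurable f flTwo := (integrable_two f).1

/-- The integral against the two-atom measure is the sum of the two values. [folklore] -/
theorem integral_two [NormedSpace ℝ E] [CompleteSpace E] (f : Fld 4 ℂ → E) : ∫ z, f z ∂flTwo = f 0 + f atomH := by
  unfold flTwo
  rw [integral_add_measure ((integrable_const (f 0)).congr (aeeq_dirac 0 f).symm)
    ((integrable_const (f atomH)).congr (aeeq_dirac atomH f).symm),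
    integral_congr_ae (aeeq_dirac 0 f), integral_congr_ae (aeeq_dirac atomH f)]
  simp

/-- Hence every complex function is in §2's integrand class `BddClass ℂ flTwo`. [folklore] -/
theorem mem_bddClass (f : Fld 4 ℂ → ℂ) : f ∈ BddClass ℂ flTwo :=
  ⟨aesm_two f, max ‖f 0‖ ‖f atomH‖, ae_two.mpr ⟨le_max_left _ _, le_max_right _ _⟩⟩

/-! ## §2 The exponent data `base ≡ 1`, `𝒜 U z = U₀₀ z₀₀ / 10`, `ref = Re`, and the logistic weight [folklore] -/

/-- The background-independent base: `≡ 1`. [folklore] -/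
def base₁ : Fld 4 ℂ → ℝ := fun _ => 1

/-- The background-DEPENDENT exponent `𝒜 U z = U₀₀·z₀₀/10`. [folklore] -/
def 𝒜₁ (U z : Fld 4 ℂ) : ℂ := ((1 / 10 : ℝ) : ℂ) * ev₀₀ U * ev₀₀ z

/-- The reference map: the real part, bond-wise. [folklore] -/
def ref₁ (U : Fld 4 ℂ) : Fld 4 ℂ := fun x ν => (((U x ν).re : ℝ) : ℂ)

/-- [folklore] -/ theorem ev₀₀_ref₁ (U : Fld 4 ℂ) : ev₀₀ (ref₁ U) = (((ev₀₀ U).re : ℝ) : ℂ) := rfl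

/-- The logistic weight of the second atom: `λ(U) = ω_U(z_H) / (1 + ω_U(z_H))`. [folklore] -/
def lam₁ (U : Fld 4 ℂ) : ℂ := expWeight base₁ 𝒜₁ U atomH / (1 + expWeight base₁ 𝒜₁ U atomH)

/-- The weight at the atom `0` is `1`. [folklore] -/
@[simp] theorem expWeight_zero (U : Fld 4 ℂ) : expWeight base₁ 𝒜₁ U 0 = 1 := by
  simp [expWeight_apply, base₁, 𝒜₁]

/-- The weight at the atom `z_H` is `e^{−𝒜 U z_H}`. [folklore] -/
theorem expWeight_atomH (U : Fld 4 ℂ) : expWeight base₁ 𝒜₁ U atomH = Complex.exp (-(𝒜₁ U atomH)) := by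
  simp [expWeight_apply, base₁]

/-- `‖𝒜 U z_H‖ = ‖U₀₀‖/500`. [folklore] -/
theorem norm_𝒜₁_atomH (U : Fld 4 ℂ) : ‖𝒜₁ U atomH‖ = ‖ev₀₀ U‖ / 500 := by
  rw [𝒜₁, ev₀₀_atomH, norm_mul, norm_mul, Complex.norm_real, Complex.norm_real, Real.norm_eq_abs, Real.norm_eq_abs,
    abs_of_pos (by norm_num : (0 : ℝ) < 1 / 10), abs_of_pos (by norm_num : (0 : ℝ) < 1 / 50)]
  ring

/-- `‖ω_U(z_H) − 1‖ ≤ 1/250` for `‖U₀₀‖ ≤ 1` (the complex bound `‖e^x − 1‖ ≤ 2‖x‖`, `‖x‖ ≤ 1`). [folklore] -/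
theorem norm_expWeight_atomH_sub_one {U : Fld 4 ℂ} (hU : ‖ev₀₀ U‖ ≤ 1) : ‖expWeight base₁ 𝒜₁ U atomH - 1‖ ≤ 1 / 250 := by
  rw [expWeight_atomH]
  have hx : ‖-(𝒜₁ U atomH)‖ ≤ 1 / 500 := by rw [norm_neg, norm_𝒜₁_atomH]; linarith
  calc ‖Complex.exp (-(𝒜₁ U atomH)) - 1‖ ≤ 2 * ‖-(𝒜₁ U atomH)‖ := Complex.norm_exp_sub_one_le (hx.trans (by norm_num))
    _ ≤ 1 / 250 := by linarith

/-- The normalisation `1 + ω_U(z_H)` does not vanish for `‖U₀₀‖ ≤ 1`. [folklore] -/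
theorem one_add_expWeight_ne_zero {U : Fld 4 ℂ} (hU : ‖ev₀₀ U‖ ≤ 1) : 1 + expWeight base₁ 𝒜₁ U atomH ≠ 0 := by
  intro h
  have h2 := norm_expWeight_atomH_sub_one hU
  rw [show expWeight base₁ 𝒜₁ U atomH - 1 = -2 by linear_combination h] at h2
  norm_num at h2

/-- `‖λ(U)‖ ≤ 3/5` for `‖U₀₀‖ ≤ 1`. [folklore] -/
theorem norm_lam₁_le {U : Fld 4 ℂ} (hU : ‖ev₀₀ U‖ ≤ 1) : ‖lam₁ U‖ ≤ 3 / 5 := by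
  have h1 := norm_expWeight_atomH_sub_one hU
  unfold lam₁
  set q := expWeight base₁ 𝒜₁ U atomH
  have hn : ‖q‖ ≤ 251 / 250 :=
    calc ‖q‖ = ‖(q - 1) + 1‖ := by rw [sub_add_cancel]
      _ ≤ ‖q - 1‖ + ‖(1 : ℂ)‖ := norm_add_le _ _
      _ ≤ 251 / 250 := by rw [norm_one]; linarith
  have hd : 499 / 250 ≤ ‖1 + q‖ := by
    have h := norm_sub_norm_le (2 : ℂ) (-(q - 1))
    rw [show (2 : ℂ) - -(q - 1) = 1 + q by ring, norm_neg] at h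
    have h2 : ‖(2 : ℂ)‖ = 2 := by simp
    linarith
  rw [norm_div, div_le_iff₀ (by linarith)]
  linarith

/-- **THE DRESSED OPERATION IN CLOSED FORM**: `wOp ω flTwo 0 U h = h 0 + λ(U)·(h z_H − h 0)` on the good set. [folklore] -/
theorem wOp_two {U : Fld 4 ℂ} (hU : 1 + expWeight base₁ 𝒜₁ U atomH ≠ 0) (h : Fld 4 ℂ → ℂ) :
    wOp (expWeight base₁ 𝒜₁) flTwo 0 U h = h 0 + lam₁ U * (h atomH - h 0) := by
  have hint : ∫ z, expWeight base₁ 𝒜₁ U z ∂flTwo = 1 + expWeight base₁ 𝒜₁ U atomH := by rw [integral_two, expWeight_zero]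
  rw [wOp_of_pos (integrable_two _) (by rw [hint]; exact hU), hint, integral_two]
  simp only [smul_eq_mul, expWeight_zero, one_mul, lam₁]
  field_simp
  ring

/-! ## §3 The carried functionals, DEFINED by the `wOp` recursion; closed forms; the oscillation bound [folklore] -/

/-- The birth functionals: `10·U₀₀` for the family born at scale `0`; `0` for the (absent) later generations. [folklore] -/
def birth (k' : ℕ) (U : Fld 4 ℂ) : ℂ := if k' = 0 then 10 * ev₀₀ U else 0

/-- The carried functionals — generation `k'` at scale `k` — by the LITERAL dressed recursion from the birth scale on. [folklore] -/
def Fn (k' : ℕ) : ℕ → Fld 4 ℂ → ℂ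
  | 0 => birth k'
  | k + 1 => fun U => if k + 1 ≤ k' then birth k' U else wOp (expWeight base₁ 𝒜₁) flTwo 0 U (fun z => Fn k' k (U + z))

/-- At its own scale a generation is its birth functional. [folklore] -/
theorem Fn_self : ∀ k', Fn k' k' = birth k'
  | 0 => rfl
  | j + 1 => by funext U; simp [Fn]

/-- `hFn` BY DEFINITION: the step `k → k+1` (`k' ≤ k`) is the dressed operation on the translates. [folklore] -/
theorem Fn_succ {k' k : ℕ} (h : k' ≤ k) (U : Fld 4 ℂ) :
    Fn k' (k + 1) U = wOp (expWeight base₁ 𝒜₁) flTwo 0 U (fun z => Fn k' k (U + z)) := by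
  simp [Fn, show ¬ (k + 1 ≤ k') by omega]

/-- [folklore] -/ @[simp] theorem Fn_zero_zero (U : Fld 4 ℂ) : Fn 0 0 U = 10 * ev₀₀ U := by simp [Fn, birth]

/-- First dressed step in closed form: `Fn 0 1 U = 10U₀₀ + λ(U)/5`. [folklore] -/
theorem Fn_one {U : Fld 4 ℂ} (hU : ‖ev₀₀ U‖ ≤ 1) : Fn 0 1 U = 10 * ev₀₀ U + lam₁ U * (1 / 5) := by
  rw [Fn_succ le_rfl, wOp_two (one_add_expWeight_ne_zero hU)]
  simp only [Fn_zero_zero, ev₀₀_add, ev₀₀_atomH, add_zero]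
  push_cast; ring

/-- [folklore] -/
theorem norm_ev₀₀_add_atomH {U : Fld 4 ℂ} (hU : ‖ev₀₀ U‖ ≤ 1 / 2) : ‖ev₀₀ (U + atomH)‖ ≤ 1 := by
  rw [ev₀₀_add, ev₀₀_atomH]
  calc ‖ev₀₀ U + ((1 / 50 : ℝ) : ℂ)‖ ≤ ‖ev₀₀ U‖ + ‖((1 / 50 : ℝ) : ℂ)‖ := norm_add_le _ _
    _ ≤ 1 / 2 + 1 / 50 := by gcongr; rw [Complex.norm_real]; norm_num
    _ ≤ 1 := by norm_num

/-- Second dressed step in closed form: `Fn 0 2 U = 10U₀₀ + (2λ(U) + λ(U)λ(U+z_H) − λ(U)²)/5`. [folklore] -/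
theorem Fn_two {U : Fld 4 ℂ} (hU : ‖ev₀₀ U‖ ≤ 1 / 2) :
    Fn 0 2 U = 10 * ev₀₀ U + (2 * lam₁ U + lam₁ U * lam₁ (U + atomH) - lam₁ U ^ 2) / 5 := by
  have h1 : ‖ev₀₀ U‖ ≤ 1 := hU.trans (by norm_num)
  rw [Fn_succ zero_le_one, wOp_two (one_add_expWeight_ne_zero h1)]
  simp only [add_zero]
  rw [Fn_one h1, Fn_one (norm_ev₀₀_add_atomH hU), ev₀₀_add, ev₀₀_atomH]
  push_cast; ring

/-- **THE DRESSING ERROR**: `‖Fn 0 k U − 10U₀₀‖ ≤ 2/5` for `k ≤ 2`, `‖U₀₀‖ ≤ ½`. [folklore] -/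
theorem norm_Fn_sub_le {k : ℕ} (hk : k ≤ 2) {U : Fld 4 ℂ} (hU : ‖ev₀₀ U‖ ≤ 1 / 2) : ‖Fn 0 k U - 10 * ev₀₀ U‖ ≤ 2 / 5 := by
  have h1 : ‖ev₀₀ U‖ ≤ 1 := hU.trans (by norm_num)
  have ha := norm_lam₁_le h1
  interval_cases k
  · norm_num
  · rw [Fn_one h1, add_sub_cancel_left, norm_mul]
    have h5 : ‖(1 / 5 : ℂ)‖ = 1 / 5 := by simp
    rw [h5]; linarith
  · have hb := norm_lam₁_le (norm_ev₀₀_add_atomH hU)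
    rw [Fn_two hU, add_sub_cancel_left, norm_div, show ‖(5 : ℂ)‖ = 5 by simp]
    have hab : ‖lam₁ U‖ * ‖lam₁ (U + atomH)‖ ≤ 3 / 5 * (3 / 5) := mul_le_mul ha hb (norm_nonneg _) (by norm_num)
    have haa : ‖lam₁ U‖ ^ 2 ≤ (3 / 5) ^ 2 := pow_le_pow_left₀ (norm_nonneg _) ha 2
    have h := (norm_sub_le (2 * lam₁ U + lam₁ U * lam₁ (U + atomH)) (lam₁ U ^ 2)).trans
      (add_le_add (norm_add_le _ _) le_rfl)
    rw [norm_mul, norm_mul, norm_pow, show ‖(2 : ℂ)‖ = 2 by simp] at h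
    rw [div_le_iff₀ (by norm_num : (0 : ℝ) < 5)]
    linarith

/-- **THE OSCILLATION**: between `0` and any `U₁` with `U₁(0,0) = 1/5` the dressed functional moves by `≥ 6/5` (`k ≤ 2`). [folklore] -/
theorem osc_ge {k : ℕ} (hk : k ≤ 2) {U₁ : Fld 4 ℂ} (h1 : ev₀₀ U₁ = 1 / 5) : 6 / 5 ≤ ‖Fn 0 k U₁ - Fn 0 k 0‖ := by
  have hU₁ : ‖ev₀₀ U₁‖ ≤ 1 / 2 := by rw [h1, show ‖(1 / 5 : ℂ)‖ = 1 / 5 by simp]; norm_num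
  have e1 := norm_Fn_sub_le hk hU₁
  have e0 := norm_Fn_sub_le hk (U := 0) (by simp)
  have hid : (10 * ev₀₀ U₁ - 10 * ev₀₀ (0 : Fld 4 ℂ)) =
      (Fn 0 k U₁ - Fn 0 k 0) - ((Fn 0 k U₁ - 10 * ev₀₀ U₁) - (Fn 0 k 0 - 10 * ev₀₀ 0)) := by ring
  have h2 : ‖10 * ev₀₀ U₁ - 10 * ev₀₀ (0 : Fld 4 ℂ)‖ = 2 := by
    rw [h1, ev₀₀_zero, mul_zero, sub_zero, show (10 : ℂ) * (1 / 5) = 2 by norm_num]; simp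
  have h3 := norm_sub_le (Fn 0 k U₁ - Fn 0 k 0) ((Fn 0 k U₁ - 10 * ev₀₀ U₁) - (Fn 0 k 0 - 10 * ev₀₀ 0))
  rw [← hid, h2] at h3
  have h4 := norm_sub_le (Fn 0 k U₁ - 10 * ev₀₀ U₁) (Fn 0 k 0 - 10 * ev₀₀ 0)
  linarith

end

end Summit.QuantumFields.BalabanUV.T4Continuum.T4TrajectoryDensityWitness
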